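import Mathlib
import HarnessLib
import Summits.HubbardSuperconductivity.HubbardSuperconductivity.Theorems.LiebTwinNoOnsiteODLROHalfFillingLiebCoordinates
import Literature.MathematicalPhysics.QuantumLattice.HubbardSzSectorLadder
import Literature.MathematicalPhysics.QuantumLattice.HubbardModelProofs
import Literature.MathematicalPhysics.QuantumLattice.HubbardHubbardModelEtaPairingProofs
import Literature.MathematicalPhysics.QuantumLattice.HubbardRingPerronFrobeniusProofs

/-!
# Gaussian domination for the Hubbard model in Lieb's coordinates (Kubo–Kishi at `T = 0`), II:
# the half-filled sectors and the torus

Helper file (`--supports stmt-HubbardSuperconductivity-0933`, crux `NoOnsiteODLRO`; route-prover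
LiebTwin-0, session 5), sequel of `LiebTwinNoOnsiteODLROHalfFillingLiebCoordinates` (the matrix-level
Gaussian domination `gaussianDomination_energy` in Lieb's hole–particle coordinates).

At half filling (`N↑ + N↓ = |Λ|`) the uniform-field term of the matrix inequality vanishes
(`expect_sum_chargeDev_eq_zero`), and the two reflected states `Φ(c_L)`, `Φ(c_R)` of the KLS trace pair
lie in the same sector as `ψ` with the same norm (`isInSector_toFock_of_sq`: a Hermitian square root of
`MMᴴ` / `MᴴM` inherits the row / column support of `M`), so any sector lower bound `E` of `H` yields
**ground-state Gaussian domination** (`gaussianDomination_halfFilled`; any bipartite graph, any `t`,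
every `U > 0`, every half-filled sector `(a, |Λ| - a)`):

  `Re⟨ψ, Σ_x h_x (n_x - 1) ψ⟩ ≤ Re⟨ψ, Hψ⟩ - E‖ψ‖² + (Σ_x h_x²/(2U)) ‖ψ‖²`,

i.e. the sector ground energy drops by at most `Σ_x h_x²/(2U)` in any charge field — Kubo–Kishi's
`χ_c ≤ 1/U` at `β = ∞`. `gaussianDomination_halfFilled_shifted` is the same with the field written as
`Σ_x h_x n_x - Σ_x h_x` (no identity matrix in the statement, so that it specialises verbatim to concrete
lattices), and `stub_halfFillingGaussianDomination` is the registered torus statement (`L` even, sector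
`(L², S^z = 0)`, `E = minEnergyOn H (szSector L² 0)`). The sequel files derive the Falk–Bruch bound on the
staggered charge fluctuation of the half-filled ground state and, through Zhang's pseudospin `SU(2)`,
`Re⟨ψ₀, P_sᴴP_sψ₀⟩ = O(L²/√U)` — the `δ = 0` endpoint of `NoOnsiteODLRO` with the summable rate.

References: K. Kubo, T. Kishi, Phys. Rev. B 41 (1990) 4866, Thm 1 [KuboKishi1990]; T. Kennedy,
E. H. Lieb, B. S. Shastry, J. Stat. Phys. 53 (1988) 1019 [KLS1988JSP]; F. J. Dyson, E. H. Lieb, B. Simon,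
J. Stat. Phys. 18 (1978) 335, Thm 4.2 [DLS1978]; E. H. Lieb, Phys. Rev. Lett. 62 (1989) 1201 [LiebPRL1989].
Everything is proved (standard axioms); no definition and no named fact is introduced.
-/

-- the mandated namespace `Summit.<Summit>.<Problem>.Theorems` repeats `HubbardSuperconductivity`

set_option linter.dupNamespace false

noncomputable section

namespace Summit.HubbardSuperconductivity.HubbardSuperconductivity.Theorems.NoOnsiteODLRO.HalfFilling

open Matrix Finset
open Literature.Probability.LatticeModels Literature.MathematicalPhysics.QuantumLattice
open Literature.MathematicalPhysics.QuantumLattice.LiebTwo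
open scoped ComplexOrder

section GaussianDomination

variable {Λ : Type*} [LinearOrder Λ] [Fintype Λ] (G : SimpleGraph Λ) [DecidableRel G.Adj]

/-! ### Support of the reflected states -/

omit [LinearOrder Λ] in
/-- A Hermitian matrix whose square has a vanishing diagonal entry `(α, α)` has zero row and
column `α`. [folklore] -/
theorem apply_eq_zero_of_sq_diag_eq_zero {m : Type*} [Fintype m] {c P : Matrix m m ℂ}
    (hc : c.IsHermitian) (hsq : c * c = P) {α : m} (hP : P α α = 0) (β : m) :
    c α β = 0 ∧ c β α = 0 := by
  have h := congrFun (congrFun hsq α) α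
  rw [mul_apply, hP] at h
  have h' : ∑ j, (Complex.normSq (c α j) : ℂ) = 0 := by
    rw [← h]
    refine Finset.sum_congr rfl fun j _ => ?_
    rw [← hc.apply j α, Complex.star_def, Complex.mul_conj]
  have h'' : ∑ j, Complex.normSq (c α j) = 0 := by exact_mod_cast h'
  have hz := (Finset.sum_eq_zero_iff_of_nonneg fun j _ => Complex.normSq_nonneg (c α j)).1 h'' β
    (Finset.mem_univ β)
  have hαβ : c α β = 0 := Complex.normSq_eq_zero.1 hz
  refine ⟨hαβ, ?_⟩
  rw [← hc.apply β α, hαβ, star_zero]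

/-- The coefficient matrix of a vector of the sector `(a, b)` is supported on rows of size `a`
and (hole) columns of size `|Λ| - b`. [folklore] -/
theorem ofFock_apply_eq_zero (A : Finset Λ) {a b : ℕ} {ψ : Fock (Orb Λ)} (hψ : IsInSector a b ψ)
    {α β : Finset Λ} (h : ¬(α.card = a ∧ βᶜ.card = b)) : ofFock A ψ α β = 0 := by
  rw [ofFock, hψ (pairSet α βᶜ) (by rwa [upPart_pairSet, downPart_pairSet]), mul_zero]

/-- **The reflected states stay in the half-filled sector.** If `a + b = |Λ|`, `ψ` lies in the
sector `(a, b)` and `c` is Hermitian with `c² = MMᴴ` or `c² = MᴴM` (`M` the coefficient matrix of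
`ψ`), then `Φ(c)` lies in the sector `(a, b)`. [folklore] -/
theorem isInSector_toFock_of_sq (A : Finset Λ) {a b : ℕ} (hab : a + b = Fintype.card Λ)
    {ψ : Fock (Orb Λ)} (hψ : IsInSector a b ψ) {c : Matrix (Finset Λ) (Finset Λ) ℂ} (hc : c.IsHermitian)
    (hsq : c * c = ofFock A ψ * (ofFock A ψ)ᴴ ∨ c * c = (ofFock A ψ)ᴴ * ofFock A ψ) :
    IsInSector a b (toFock A c) := by
  -- rows/columns of `c` off the size-`a` configurations vanish
  have hsupp : ∀ α β : Finset Λ, α.card ≠ a → c α β = 0 ∧ c β α = 0 := by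
    intro α β hα
    rcases hsq with hsq | hsq
    · refine apply_eq_zero_of_sq_diag_eq_zero hc hsq ?_ β
      rw [mul_apply]
      refine Finset.sum_eq_zero fun γ _ => ?_
      rw [ofFock_apply_eq_zero A hψ (fun h => hα h.1), zero_mul]
    · refine apply_eq_zero_of_sq_diag_eq_zero hc hsq ?_ β
      rw [mul_apply]
      refine Finset.sum_eq_zero fun γ _ => ?_
      rw [conjTranspose_apply, ofFock_apply_eq_zero A hψ (fun h => hα ?_), mul_zero]
      have := h.2
      rw [Finset.card_compl] at this
      have hle := Finset.card_le_univ α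
      omega
  intro s hs
  rw [← pairSet_upPart_downPart s, toFock_pairSet]
  by_cases h1 : (upPart s).card = a
  · have h2 : (downPart s).card ≠ b := fun h2 => hs ⟨h1, h2⟩
    have h3 : ((downPart s)ᶜ).card ≠ a := by
      rw [Finset.card_compl]
      intro h3
      apply h2
      have := Finset.card_le_univ (downPart s)
      omega
    rw [(hsupp _ (upPart s) h3).2, mul_zero]
  · rw [(hsupp _ ((downPart s)ᶜ) h1).1, mul_zero]

/-- `Σ_x (n_{x↑} + n_{x↓} - 1) = N - |Λ|`. [folklore] -/
theorem sum_chargeDev_eq :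
    (∑ x : Λ, (numberOp x 0 + numberOp x 1 - 1) : Matrix (Finset (Orb Λ)) (Finset (Orb Λ)) ℂ) =
      totalNumber - (Fintype.card Λ : ℂ) • (1 : Matrix (Finset (Orb Λ)) (Finset (Orb Λ)) ℂ) := by
  rw [totalNumber, Finset.sum_sub_distrib, Finset.sum_const, Finset.card_univ, ← Nat.cast_smul_eq_nsmul ℂ]
  congr 1
  exact Finset.sum_congr rfl fun x _ => (Fin.sum_univ_two _).symm

/-- On an `N`-particle vector the total number acts as `N`. [folklore] -/
theorem totalNumber_mulVec_of_isNParticle {N : ℕ} {ψ : Fock (Orb Λ)} (hψ : IsNParticle N ψ) :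
    totalNumber *ᵥ ψ = (N : ℂ) • ψ := by
  funext s
  rw [totalNumber_mulVec, Pi.smul_apply, smul_eq_mul]
  by_cases hs : s.card = N
  · rw [hs]
  · rw [hψ s hs, mul_zero, mul_zero]

/-- At half filling the uniform charge field has zero expectation:
`⟨ψ, Σ_x (n_{x↑} + n_{x↓} - 1) ψ⟩ = 0` for `ψ` in a sector `(a, b)` with `a + b = |Λ|`. [folklore] -/
theorem expect_sum_chargeDev_eq_zero {a b : ℕ} (hab : a + b = Fintype.card Λ) {ψ : Fock (Orb Λ)}
    (hψ : IsInSector a b ψ) :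
    star ψ ⬝ᵥ ((∑ x : Λ, (numberOp x 0 + numberOp x 1 - 1)) *ᵥ ψ) = 0 := by
  rw [sum_chargeDev_eq, sub_mulVec, totalNumber_mulVec_of_isNParticle hψ.isNParticle, smul_mulVec,
    one_mulVec, ← sub_smul, hab, sub_self, zero_smul, dotProduct_zero]

/-- **Ground-state Gaussian domination for the half-filled Hubbard model** (Kubo–Kishi at `T = 0`).
On a bipartite graph (colour class `A`), for `U > 0`, a half-filled sector `(N↑, N↓) = (a, b)`,
`a + b = |Λ|`, any lower bound `E` of `H = hamiltonian G t U` on that sector, every `ψ` in the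
sector and every real field `h`:
`Re⟨ψ, Σ_x h_x (n_x - 1) ψ⟩ ≤ Re⟨ψ, Hψ⟩ - E‖ψ‖² + (Σ_x h_x²/(2U)) ‖ψ‖²`
(taking the infimum over unit `ψ`: `E₀ - E₀(h) ≤ Σ_x h_x²/(2U)` for the ground energy `E₀(h)` of
`H - Σ_x h_x(n_x - 1)` in the sector). Kubo–Kishi, PRB 41 (1990) 4866, Thm 1 (`β → ∞`);
Dyson–Lieb–Simon, J. Stat. Phys. 18 (1978) 335, Thm 4.2. [cite: KuboKishi1990, Theorem 1] -/
theorem gaussianDomination_halfFilled (A : Finset Λ) (hA : ∀ x y : Λ, G.Adj x y → (x ∈ A ↔ y ∉ A))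
    (t : ℝ) {U : ℝ} (hU : 0 < U) {a b : ℕ} (hab : a + b = Fintype.card Λ) {E : ℝ}
    (hE : ∀ φ : Fock (Orb Λ), IsInSector a b φ →
      E * (star φ ⬝ᵥ φ).re ≤ (star φ ⬝ᵥ (hamiltonian G t U *ᵥ φ)).re)
    {ψ : Fock (Orb Λ)} (hψ : IsInSector a b ψ) (h : Λ → ℝ) :
    (star ψ ⬝ᵥ ((∑ x : Λ, ((h x : ℝ) : ℂ) • (numberOp x 0 + numberOp x 1 - 1)) *ᵥ ψ)).re ≤
      (star ψ ⬝ᵥ (hamiltonian G t U *ᵥ ψ)).re - E * (star ψ ⬝ᵥ ψ).re +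
        (∑ x : Λ, h x ^ 2) / (2 * U) * (star ψ ⬝ᵥ ψ).re := by
  obtain ⟨M, rfl⟩ : ∃ M, ψ = toFock A M := ⟨ofFock A ψ, (toFock_ofFock A ψ).symm⟩
  have hM : ofFock A (toFock A M) = M := ofFock_toFock A M
  obtain ⟨cL, cR, hL, hR, hLsq, hRsq, hGD⟩ := gaussianDomination_energy G t hU h M
  -- the reflected states are in the sector, with the norm of `ψ`
  have hsecL : IsInSector a b (toFock A cL) :=
    isInSector_toFock_of_sq A hab hψ hL.1 (Or.inl (by rw [hM]; exact hLsq))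
  have hsecR : IsInSector a b (toFock A cR) :=
    isInSector_toFock_of_sq A hab hψ hR.1 (Or.inr (by rw [hM]; exact hRsq))
  have hnormL : star (toFock A cL) ⬝ᵥ toFock A cL = star (toFock A M) ⬝ᵥ toFock A M := by
    rw [star_toFock_dotProduct_toFock, star_toFock_dotProduct_toFock, hsInner, hsInner, hL.1.eq, hLsq,
      trace_mul_comm]
  have hnormR : star (toFock A cR) ⬝ᵥ toFock A cR = star (toFock A M) ⬝ᵥ toFock A M := by
    rw [star_toFock_dotProduct_toFock, star_toFock_dotProduct_toFock, hsInner, hsInner, hR.1.eq, hRsq]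
  have hEL := hE _ hsecL
  have hER := hE _ hsecR
  rw [hnormL, expect_hamiltonian_toFock G A hA] at hEL
  rw [hnormR, expect_hamiltonian_toFock G A hA] at hER
  -- the zero-field term vanishes at half filling
  have h0 := expect_chargeField_toFock A (fun _ => (1 : ℝ)) M
  simp only [Complex.ofReal_one, one_smul, one_mul] at h0
  rw [expect_sum_chargeDev_eq_zero hab hψ] at h0
  have h0re : ∑ x : Λ, (((Mᴴ * numberAt x * M).trace).re - ((Mᴴ * M * numberAt x).trace).re) = 0 := by
    have := congrArg Complex.re h0
    rw [Complex.zero_re, Complex.re_sum] at this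
    rw [this]
    exact Finset.sum_congr rfl fun x _ => by rw [Complex.sub_re]
  rw [h0re, mul_zero, sub_zero] at hGD
  -- assemble
  rw [expect_chargeField_toFock, expect_hamiltonian_toFock G A hA, star_toFock_dotProduct_toFock,
    Complex.re_sum]
  have hlhs : ∑ x : Λ, (((h x : ℝ) : ℂ) * ((Mᴴ * numberAt x * M).trace - (Mᴴ * M * numberAt x).trace)).re =
      ∑ x : Λ, h x * (((Mᴴ * numberAt x * M).trace).re - ((Mᴴ * M * numberAt x).trace).re) :=
    Finset.sum_congr rfl fun x _ => by rw [Complex.re_ofReal_mul, Complex.sub_re]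
  rw [hlhs]
  have hτ : (hsInner M M).re = ((Mᴴ * M).trace).re := rfl
  rw [star_toFock_dotProduct_toFock] at hEL hER
  rw [hτ] at hEL hER ⊢
  linarith


/-- **Ground-state Gaussian domination, shifted form** (no identity matrix in the statement, so
that it specialises verbatim to concrete lattices):
`Re⟨ψ, Σ_x h_x n_x ψ⟩ - (Σ_x h_x)‖ψ‖² ≤ Re⟨ψ, Hψ⟩ - E‖ψ‖² + (Σ_x h_x²/(2U)) ‖ψ‖²` under the hypotheses
of `gaussianDomination_halfFilled`. Kubo–Kishi, PRB 41 (1990) 4866, Thm 1. [cite: KuboKishi1990, Theorem 1] -/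
theorem gaussianDomination_halfFilled_shifted (A : Finset Λ)
    (hA : ∀ x y : Λ, G.Adj x y → (x ∈ A ↔ y ∉ A)) (t : ℝ) {U : ℝ} (hU : 0 < U) {a b : ℕ}
    (hab : a + b = Fintype.card Λ) {E : ℝ}
    (hE : ∀ φ : Fock (Orb Λ), IsInSector a b φ →
      E * (star φ ⬝ᵥ φ).re ≤ (star φ ⬝ᵥ (hamiltonian G t U *ᵥ φ)).re)
    {ψ : Fock (Orb Λ)} (hψ : IsInSector a b ψ) (h : Λ → ℝ) :
    (star ψ ⬝ᵥ ((∑ x : Λ, ((h x : ℝ) : ℂ) • (numberOp x 0 + numberOp x 1)) *ᵥ ψ)).re -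
        (∑ x : Λ, h x) * (star ψ ⬝ᵥ ψ).re ≤
      (star ψ ⬝ᵥ (hamiltonian G t U *ᵥ ψ)).re - E * (star ψ ⬝ᵥ ψ).re +
        (∑ x : Λ, h x ^ 2) / (2 * U) * (star ψ ⬝ᵥ ψ).re := by
  have key := gaussianDomination_halfFilled G A hA t hU hab hE hψ h
  have hsplit : (∑ x : Λ, ((h x : ℝ) : ℂ) • (numberOp x 0 + numberOp x 1 - 1)) *ᵥ ψ =
      (∑ x : Λ, ((h x : ℝ) : ℂ) • (numberOp x 0 + numberOp x 1)) *ᵥ ψ -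
        ((∑ x : Λ, h x : ℝ) : ℂ) • ψ := by
    simp only [smul_sub, Finset.sum_sub_distrib, sub_mulVec, Matrix.sum_mulVec, smul_mulVec, one_mulVec,
      Complex.ofReal_sum, Finset.sum_smul]
  rw [hsplit, dotProduct_sub, dotProduct_smul, Complex.sub_re, smul_eq_mul, Complex.re_ofReal_mul] at key
  exact key

end GaussianDomination

/-! ### The Hubbard torus at half filling -/

section Torus

variable {L : ℕ}

/-- The even sublattice `A = {torusStagger = 1}` is a bipartite colouring of the torus of even side.
Lieb, PRL 62 (1989) 1201. [folklore] -/
theorem torus_colouring (hL : Even L) (x y : FermionTorus 2 L) (h : (fermionTorusGraph 2 L).Adj x y) :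
    x ∈ (Finset.univ.filter fun z : FermionTorus 2 L => torusStagger z = 1) ↔
      y ∉ (Finset.univ.filter fun z : FermionTorus 2 L => torusStagger z = 1) := by
  have hε := torusStagger_eq_neg_of_adj_holds hL h
  have hne : (-1 : ℤˣ) ≠ 1 := by decide
  simp only [Finset.mem_filter, Finset.mem_univ, true_and]
  rcases Int.units_eq_one_or (torusStagger y) with hy | hy
  · rw [hε, hy]; exact iff_of_false hne (fun h => h rfl)
  · rw [hε, hy, neg_neg]; exact iff_of_true rfl hne

/-- **Registered stub `stub_halfFillingGaussianDomination`** of crux `NoOnsiteODLRO`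
(stmt-HubbardSuperconductivity-0933; by-product — the `δ = 0` endpoint, not a piece of a line
composition): **ground-state Gaussian domination for the half-filled Hubbard torus.** For `U > 0`, `L`
even, `2n = L²`, every `ψ` of the sector `(N↑, N↓) = (n, n)` and every real field `h`,
`Re⟨ψ, Σ_x h_x n_x ψ⟩ - (Σ_x h_x)‖ψ‖² ≤ Re⟨ψ, Hψ⟩ - E(L², 0) ‖ψ‖² + (Σ_x h_x²/(2U)) ‖ψ‖²`
(`n_x = n_{x↑} + n_{x↓}`), `H = hubbardTorus 2 L 1 U`, `E(L², 0) = minEnergyOn H (szSector L² 0)`: the sector ground energy drops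
by at most `Σ_x h_x²/(2U)` under any charge field — Kubo–Kishi's bound on the charge susceptibility,
`χ_c ≤ 1/U`, at zero temperature. Kubo–Kishi, PRB 41 (1990) 4866, Thm 1; Kennedy–Lieb–Shastry,
J. Stat. Phys. 53 (1988) 1019, eqs. (20)–(25). [cite: KuboKishi1990, Theorem 1] -/
theorem stub_halfFillingGaussianDomination : open Literature.MathematicalPhysics.QuantumLattice in ∀ (U : ℝ), 0 < U → ∀ (L : ℕ) [NeZero L], Even L → ∀ (n : ℕ), 2 * n = L ^ 2 → ∀ ψ : Fock (Orb (FermionTorus 2 L)), IsInSector n n ψ → ∀ h : FermionTorus 2 L → ℝ, (star ψ ⬝ᵥ ((∑ x : FermionTorus 2 L, ((h x : ℝ) : ℂ) • (numberOp x 0 + numberOp x 1)) *ᵥ ψ)).re - (∑ x : FermionTorus 2 L, h x) * (star ψ ⬝ᵥ ψ).re ≤ (star ψ ⬝ᵥ (hubbardTorus 2 L 1 U *ᵥ ψ)).re - (hubbardTorus 2 L 1 U).minEnergyOn (szSector (2 * n) 0) * (star ψ ⬝ᵥ ψ).re + (∑ x : FermionTorus 2 L, h x ^ 2) / (2 * U)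 * (star ψ ⬝ᵥ ψ).re := by
  intro U hU L _ hL n hn ψ hψ h
  have hcard : Fintype.card (FermionTorus 2 L) = L ^ 2 := card_fermionTorus 2 L
  have hnn : n + n = Fintype.card (FermionTorus 2 L) := by omega
  have hnle : n ≤ Fintype.card (FermionTorus 2 L) := by omega
  have hvar : ∀ φ : Fock (Orb (FermionTorus 2 L)), IsInSector n n φ →
      (hamiltonian (fermionTorusGraph 2 L) 1 U).minEnergyOn (szSector (2 * n) 0) * (star φ ⬝ᵥ φ).re ≤
        (star φ ⬝ᵥ (hamiltonian (fermionTorusGraph 2 L) 1 U *ᵥ φ)).re :=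
    fun φ hφ => (szSector_groundState (fermionTorusGraph 2 L) 1 U hnle).2 φ hφ
  exact gaussianDomination_halfFilled_shifted (fermionTorusGraph 2 L)
    (Finset.univ.filter fun z : FermionTorus 2 L => torusStagger z = 1) (torus_colouring hL) 1 hU hnn hvar
    hψ h

end Torus

end Summit.HubbardSuperconductivity.HubbardSuperconductivity.Theorems.NoOnsiteODLRO.HalfFilling
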